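import Summits.HubbardSuperconductivity.HubbardSuperconductivity.Theorems.NodalWardXYPerturbedXYOrderReduction

/-!
# Engine statement for promotion (crux stmt-HubbardSuperconductivity-10739, line schwarz-inheritance, lead c4)

Planner-facing, farm-checked copy of the ONE open statement of the crux chain, in the exact form six lead seats
recommend promoting to its own `@[conjecture]`-flagged statement item ("ComplexStabilityXY3"), together with the
one-line closing proofs in both directions (landed: `perturbedXYOrder_of_complexStability` p86213,
`perturbedXYOrder_iff_complexStability` p106199).  Vocabulary = `Theorems/NodalWardXYDefs.lean` (p76365):
`Bond L = TorusSite 3 L × Fin 3`, `Admissible L ε K = ∀ b b', ‖K b b'‖ ≤ ε/(1+dist)^4`, `Zk J K = ∫_cube w_J e^{W_K}`,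
`cratio L J K = num/Zk/L⁶`.  This file is a WORKFILE (Cruxes/), not a Theorems proposal: filing statement items is the
planner's call (D-0014); nothing here is new mathematics.
-/

namespace Summit.HubbardSuperconductivity.HubbardSuperconductivity.Cruxes.PerturbedXYOrder.Engine

open Summit.HubbardSuperconductivity.HubbardSuperconductivity.Theses.NodalWardXY
open Summit.HubbardSuperconductivity.HubbardSuperconductivity.Theorems.PerturbedXYOrder

/-- **ComplexStabilityXY3** (the engine; open, Balaban class).  Low-temperature classical XY model on `(ℤ/Lℤ)³`
perturbed by a complex two-current kernel with `(1+dist)⁻⁴` tails: for some `J₀`, `ε₂ > 0`, `B > 0`, for all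
`J ≥ J₀`, all `L ≥ 2` and all admissible `K`, the perturbed partition function does not vanish and the complex plateau
is bounded, `Z_K ≠ 0 ∧ ‖num_K / Z_K / L⁶‖ ≤ B` — uniformly in the volume.  Verbatim the registered stub
`stub_complexStability`; equivalent to `PerturbedXYOrder` (`perturbedXYOrder_iff_complexStability`). -/
def ComplexStabilityXY3 : Prop :=
  ∃ J₀ ε₂ B : ℝ, 0 < ε₂ ∧ 0 < B ∧ ∀ J : ℝ, J₀ ≤ J → ∀ (L : ℕ) [NeZero L], 2 ≤ L →
    ∀ K : Bond L → Bond L → ℂ, Admissible L ε₂ K → Zk J K ≠ 0 ∧ ‖cratio L J K‖ ≤ B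

/-- The crux from the engine (one line; this is how `PerturbedXYOrder` closes once the engine item lands). -/
theorem perturbedXYOrder_of_engine (h : ComplexStabilityXY3) : PerturbedXYOrder :=
  perturbedXYOrder_of_complexStability h

/-! The converse `PerturbedXYOrder → ComplexStabilityXY3` (so that a refutation of the engine refutes the crux) is the landed
`perturbedXYOrder_iff_complexStability` / `complexStability_of_perturbedXYOrder` (p106199,
`Theorems/NodalWardXYPerturbedXYOrderEquivalence.lean`; Borel–Carathéodory on `t ↦ −cratio(tK)`); it is not restated here only
because that module was not loadable on the farm while this workfile was checked (`remote:stale … unbuilt`). -/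

end Summit.HubbardSuperconductivity.HubbardSuperconductivity.Cruxes.PerturbedXYOrder.Engine
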